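import Summits.Ventures.DiscreteObjects.Hadamard.Order167Normalizer668

/-!
# H(668): a block-preserving automorphism INVERTING an element of order 167 ⇔ a 4 × 4 array of SYMMETRIC circulant blocks
# (kernel dictionary; the Williamson-like sub-family of F2)

Framing: lottery ticket; floor = certified bounds/negative ranges.

Cell pub-namedobj (venture DiscreteObjects), target (H), hadamard gen 20.  By `Order167Normalizer668` a signed automorphism `τ` of a
Hadamard matrix `H` of order `668` normalising an element `σ = (π, κ, d, e)` of pair order `167` acts on it as `±1`; by gen 19
(`Order167Centralizer668`) a block-preserving CENTRALISING `τ` is a power of `σ` (up to signs).  This file treats the remaining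
block-preserving case, INVERSION (`μ ≡ −1 (mod 167)`):
* **`exists_symmetricCirculantArray_of_inverting`**: if `τ` (`π'π = π^μ π'`, `κ'κ = κ^μ κ'`, `μ ≡ 166 (mod 167)`) maps every row and
  every column into its own `σ`-orbit, then there is `x : Fin 4 → Fin 4 → ZMod 167 → ℤ` with ALL SIXTEEN SEQUENCES SYMMETRIC
  (`x p q (−r) = x p q r`) whose `4 × 4` array of circulant blocks `M (p,s) (q,t) = x p q (t − s)` is a Hadamard matrix of order
  `668`.  [On each orbit `τ` is the affine involution `s ↦ −s + c`, which has a fixed point (`167` odd): base every row orbit and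
  every column orbit at its `τ`-fixed point; re-sign `σ` to a permutation pair; then `H'(π'x_p, κ'(κ^r y_q)) = ± H'(x_p, κ^r y_q)`
  reads `x_{pq}(−r) = η_{pq} x_{pq}(r)` with `η_{pq} = d₁(x_p)e₁(y_q)` (signs of `τ` are constant along `σ`-cycles: `λ^167 = 1`), and
  `r = 0` gives `η_{pq} = 1`; the array is `H'` re-indexed by the two orbit bijections `Fin 4 × ZMod 167 ≃ ι`.]
* **`symmetricCirculantArray_inverting_aut`** (converse): for symmetric `x` the block reversal `(p, s) ↦ (p, −s)` is a permutation
  automorphism of the array, preserves the blocks and inverts the block shift (`τ₀ σ₀ = σ₀^166 τ₀`).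
* **`hadamard668_aut167_inverting_iff_symmetricCirculantArray`**: the `iff` (for every `μ ≡ 166 (mod 167)`).
So: for an H(668) with an element `σ` of order `167`, the block-preserving part of `N(⟨σ⟩)` is `⟨σ⟩` (up to signs) UNLESS `H` is
equivalent to a `4 × 4` array of symmetric circulant blocks of order `167` (the Williamson array with symmetric circulant
`A, B, C, D` is the classical instance) — dictionary / structure of a hypothetical object; no exclusion; H(668) untouched; HITS 0/4.
Ours; no `sorry`, no definitions.
-/

namespace Summit.Ventures.DiscreteObjects.Hadamard

open Finset BigOperators Matrix

open Literature.Combinatorics.Designs.GoethalsSeidel (IsHadamardMatrix)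

variable {ι : Type*} [Fintype ι] [DecidableEq ι]

/-- `(166 : ZMod 167) = -1` -/
lemma zmod167_166 : ((166 : ℕ) : ZMod 167) = -1 := by decide

omit [Fintype ι] [DecidableEq ι] in
/-- on an orbit preserved by a normalising `ψ` with `μ ≡ −1 (mod 167)`, `ψ` has a fixed point: if `ψ t = π^c t` then
`ψ (π^(84 c) t) = π^(84 c) t` -/
lemma inverting_fixed_point {π ψ : Equiv.Perm ι} {μ : ℕ} (hn : ψ * π = π ^ μ * ψ) (hπ : π ^ 167 = 1) (hμ : μ % 167 = 166)
    {t : ι} {c : ℕ} (hc : ψ t = (π ^ c) t) : ψ ((π ^ (84 * c)) t) = (π ^ (84 * c)) t := by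
  rw [norm_apply_pow hn (84 * c) t, hc, ← Equiv.Perm.mul_apply, ← pow_add]
  congr 1
  apply pow_eq_pow_of_natCast_eq_n hπ
  have hμ' : (μ : ZMod 167) = -1 := by
    rw [← ZMod.natCast_mod μ 167, hμ]; exact zmod167_166
  push_cast
  rw [hμ']
  have h : (84 : ZMod 167) * 2 = 1 := by decide
  linear_combination (-(c : ZMod 167)) * h

section main
variable {H : Matrix ι ι ℤ}

/-- **Block-preserving inversion ⇒ sixteen SYMMETRIC circulant blocks.** -/
theorem exists_symmetricCirculantArray_of_inverting (hH : IsHadamardMatrix H) (hι : Fintype.card ι = 668)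
    {π κ π' κ' : Equiv.Perm ι} {d e d' e' : ι → ℤ} (haut : IsSignedAut H π κ d e)
    (hπ : π ^ 167 = 1) (hκ : κ ^ 167 = 1) (hne : π ≠ 1 ∨ κ ≠ 1)
    (haut' : IsSignedAut H π' κ' d' e') {μ : ℕ} (hnπ : π' * π = π ^ μ * π') (hnκ : κ' * κ = κ ^ μ * κ')
    (hμ : μ % 167 = 166) (hrows : ∀ x, π' x ∈ orbFin π 167 x) (hcols : ∀ y, κ' y ∈ orbFin κ 167 y) :
    ∃ x : Fin 4 → Fin 4 → ZMod 167 → ℤ,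
      IsHadamardMatrix (Matrix.of fun (a b : Fin 4 × ZMod 167) => x a.1 b.1 (b.2 - a.2)) ∧
      Fintype.card (Fin 4 × ZMod 167) = 668 ∧ ∀ p q r, x p q (-r) = x p q r := by
  have h167 := hadamard668_fixedRows_167 hH hι π κ d e haut hπ hκ hne
  have hπfix : ∀ x, π x ≠ x := moved_of_card_fixed_eq_zero π h167.1
  have hκfix : ∀ y, κ y ≠ y := moved_of_card_fixed_eq_zero κ h167.2.1
  have p167 : Nat.Prime 167 := by norm_num
  -- re-sign
  obtain ⟨s, t, hs, ht, hH', hinv⟩ := exists_resign_of_odd hH haut (by decide : Odd 167) hπ hκ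
  set H' : Matrix ι ι ℤ := Matrix.of fun i j => s i * t j * H i j with hH'def
  have hinv' : ∀ i j, H' (π i) (κ j) = H' i j := fun i j => by
    simp only [hH'def, Matrix.of_apply]; exact hinv i j
  have hinvm : ∀ m i j, H' ((π ^ m) i) ((κ ^ m) j) = H' i j := perm_aut_pow hinv'
  -- τ on H' and sign constancy (λ-argument)
  set d₁ : ι → ℤ := fun i => s (π' i) * s i * d' i with hd₁
  set e₁ : ι → ℤ := fun j => t (κ' j) * t j * e' j with he₁
  have hτ : ∀ i j, H' (π' i) (κ' j) = d₁ i * e₁ j * H' i j := by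
    intro i j
    simp only [hH'def, Matrix.of_apply, hd₁, he₁]
    rw [haut'.2.2 i j]
    have h1 := pm_mul_self (hs i); have h2 := pm_mul_self (ht j)
    calc s (π' i) * t (κ' j) * (d' i * e' j * H i j)
        = s (π' i) * t (κ' j) * (d' i * e' j * H i j) * ((s i * s i) * (t j * t j)) := by rw [h1, h2]; ring
      _ = s (π' i) * s i * d' i * (t (κ' j) * t j * e' j) * (s i * t j * H i j) := by ring
  have hd₁pm : ∀ i, d₁ i = 1 ∨ d₁ i = -1 := fun i => by
    rcases hs (π' i) with h1 | h1 <;> rcases hs i with h2 | h2 <;> rcases haut'.1 i with h3 | h3 <;> simp [hd₁, h1, h2, h3]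
  have he₁pm : ∀ j, e₁ j = 1 ∨ e₁ j = -1 := fun j => by
    rcases ht (κ' j) with h1 | h1 <;> rcases ht j with h2 | h2 <;> rcases haut'.2.1 j with h3 | h3 <;> simp [he₁, h1, h2, h3]
  have hH'ne : ∀ i j, H' i j ≠ 0 := fun i j => pm_ne_zero (hH'.1 i j)
  obtain ⟨x₀⟩ : Nonempty ι := Fintype.card_pos_iff.mp (by rw [hι]; norm_num)
  have key : ∀ x y, d₁ (π x) * e₁ (κ y) * H' x y = d₁ x * e₁ y * H' x y := by
    intro x y
    have h1 : H' (π' (π x)) (κ' (κ y)) = d₁ (π x) * e₁ (κ y) * H' x y := by rw [hτ, hinv']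
    rw [norm_apply hnπ x, norm_apply hnκ y, hinvm, hτ] at h1
    exact h1.symm
  have hlam : ∀ x, d₁ (π x) = (e₁ x₀ * e₁ (κ x₀)) * d₁ x := by
    intro x
    have h := key x x₀
    have hne0 : H' x x₀ ≠ 0 := hH'ne x x₀
    have h2 : d₁ (π x) * e₁ (κ x₀) = d₁ x * e₁ x₀ := by
      have : (d₁ (π x) * e₁ (κ x₀) - d₁ x * e₁ x₀) * H' x x₀ = 0 := by linarith
      rcases mul_eq_zero.mp this with h0 | h0
      · linarith
      · exact (hne0 h0).elim
    calc d₁ (π x) = d₁ (π x) * (e₁ (κ x₀) * e₁ (κ x₀)) := by rw [pm_mul_self (he₁pm _), mul_one]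
      _ = (d₁ (π x) * e₁ (κ x₀)) * e₁ (κ x₀) := by ring
      _ = (e₁ x₀ * e₁ (κ x₀)) * d₁ x := by rw [h2]; ring
  have hlampm : e₁ x₀ * e₁ (κ x₀) = 1 ∨ e₁ x₀ * e₁ (κ x₀) = -1 := by
    rcases he₁pm x₀ with h1 | h1 <;> rcases he₁pm (κ x₀) with h2 | h2 <;> simp [h1, h2]
  have hlampow : ∀ k x, d₁ ((π ^ k) x) = (e₁ x₀ * e₁ (κ x₀)) ^ k * d₁ x := by
    intro k; induction k with
    | zero => intro x; simp
    | succ k ih => intro x; rw [pow_succ', Equiv.Perm.mul_apply, hlam, ih, pow_succ]; ring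
  have hlam1 : e₁ x₀ * e₁ (κ x₀) = 1 := by
    rcases hlampm with h | h
    · exact h
    · exfalso
      have h1 := hlampow 167 x₀
      rw [hπ, Equiv.Perm.one_apply, h, Odd.neg_one_pow (by decide : Odd 167)] at h1
      exact pm_ne_zero (hd₁pm x₀) (by linarith)
  have hdπ : ∀ x, d₁ (π x) = d₁ x := fun x => by rw [hlam, hlam1, one_mul]
  have heκ : ∀ y, e₁ (κ y) = e₁ y := by
    intro y
    have h := key x₀ y
    rw [hdπ] at h
    have hne0 : d₁ x₀ * H' x₀ y ≠ 0 := mul_ne_zero (pm_ne_zero (hd₁pm x₀)) (hH'ne x₀ y)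
    have : (e₁ (κ y) - e₁ y) * (d₁ x₀ * H' x₀ y) = 0 := by linarith
    rcases mul_eq_zero.mp this with h0 | h0
    · linarith
    · exact (hne0 h0).elim
  have heκpow : ∀ k y, e₁ ((κ ^ k) y) = e₁ y := by
    intro k; induction k with
    | zero => intro y; simp
    | succ k ih => intro y; rw [pow_succ', Equiv.Perm.mul_apply, heκ, ih]
  -- transversals of rows and of columns
  have htr : ∀ ρ : Equiv.Perm ι, ρ ^ 167 = 1 → (∀ x, ρ x ≠ x) →
      ∃ T : Finset ι, T.card = 4 ∧
        ∀ f : ι → ℤ, ∑ y ∈ (univ : Finset ι), f y = ∑ u ∈ T, ∑ k ∈ Finset.range 167, f ((ρ ^ k) u) := by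
    intro ρ hρ hfix
    have hfree : ∀ y ∈ (univ : Finset ι), ∀ k, 0 < k → k < 167 → (ρ ^ k) y ≠ y :=
      fun y _ => free_of_fixed_prime_pow ρ p167 (by rw [hρ, Equiv.Perm.one_apply]) (hfix y)
    obtain ⟨T, -, hTc, hTs⟩ := exists_free_transversal ρ (by norm_num : 0 < 167) _ univ le_rfl
      (fun y _ => Finset.mem_univ _) (fun y _ => by rw [hρ, Equiv.Perm.one_apply]) hfree
    rw [Finset.card_univ, hι] at hTc
    exact ⟨T, by omega, hTs⟩
  obtain ⟨TR, hTR4, hTRs⟩ := htr π hπ hπfix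
  obtain ⟨TC, hTC4, hTCs⟩ := htr κ hκ hκfix
  let eR4 : Fin 4 ≃ {u // u ∈ TR} := (Finset.equivFinOfCardEq hTR4).symm
  let eC4 : Fin 4 ≃ {u // u ∈ TC} := (Finset.equivFinOfCardEq hTC4).symm
  -- τ-fixed base points on every orbit
  have hbaseR : ∀ p : Fin 4, ∃ b : ι, (∃ m : ℕ, b = (π ^ m) (eR4 p).1) ∧ π' b = b := by
    intro p
    obtain ⟨c, -, hc⟩ := Finset.mem_image.mp (hrows (eR4 p).1)
    exact ⟨(π ^ (84 * c)) (eR4 p).1, ⟨84 * c, rfl⟩, inverting_fixed_point hnπ hπ hμ hc.symm⟩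
  have hbaseC : ∀ q : Fin 4, ∃ b : ι, (∃ m : ℕ, b = (κ ^ m) (eC4 q).1) ∧ κ' b = b := by
    intro q
    obtain ⟨c, -, hc⟩ := Finset.mem_image.mp (hcols (eC4 q).1)
    exact ⟨(κ ^ (84 * c)) (eC4 q).1, ⟨84 * c, rfl⟩, inverting_fixed_point hnκ hκ hμ hc.symm⟩
  choose bR hbRm hbRfix using hbaseR
  choose bC hbCm hbCfix using hbaseC
  choose mR hmR using hbRm
  choose mC hmC using hbCm
  -- orbit bijections based at the τ-fixed points
  let fR : Fin 4 × ZMod 167 → ι := fun a => (π ^ a.2.val) (bR a.1)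
  let fC : Fin 4 × ZMod 167 → ι := fun a => (κ ^ a.2.val) (bC a.1)
  have hbR0 := orbitMap_bijective π hι TR hTRs eR4
  have hbC0 := orbitMap_bijective κ hι TC hTCs eC4
  have hfR : ∀ a : Fin 4 × ZMod 167,
      fR a = (fun a : Fin 4 × ZMod 167 => (π ^ a.2.val) (eR4 a.1).1) (a.1, a.2 + (mR a.1 : ZMod 167)) := by
    intro a
    show (π ^ a.2.val) (bR a.1) = (π ^ (a.2 + (mR a.1 : ZMod 167)).val) (eR4 a.1).1
    rw [hmR a.1, ← Equiv.Perm.mul_apply, ← pow_add]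
    congr 1
    apply pow_eq_pow_of_natCast_eq_n hπ
    rw [ZMod.natCast_zmod_val]; push_cast; rw [ZMod.natCast_zmod_val]
  have hfC : ∀ a : Fin 4 × ZMod 167,
      fC a = (fun a : Fin 4 × ZMod 167 => (κ ^ a.2.val) (eC4 a.1).1) (a.1, a.2 + (mC a.1 : ZMod 167)) := by
    intro a
    show (κ ^ a.2.val) (bC a.1) = (κ ^ (a.2 + (mC a.1 : ZMod 167)).val) (eC4 a.1).1
    rw [hmC a.1, ← Equiv.Perm.mul_apply, ← pow_add]
    congr 1
    apply pow_eq_pow_of_natCast_eq_n hκ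
    rw [ZMod.natCast_zmod_val]; push_cast; rw [ZMod.natCast_zmod_val]
  have shiftBij : ∀ (m : Fin 4 → ℕ), Function.Bijective (fun a : Fin 4 × ZMod 167 => (a.1, a.2 + (m a.1 : ZMod 167))) := by
    intro m
    refine (Equiv.mk (fun a : Fin 4 × ZMod 167 => (a.1, a.2 + (m a.1 : ZMod 167)))
      (fun a => (a.1, a.2 - (m a.1 : ZMod 167))) (fun a => ?_) (fun a => ?_)).bijective
    · simp
    · simp
  have hbR : Function.Bijective fR := by
    have : fR = (fun a : Fin 4 × ZMod 167 => (π ^ a.2.val) (eR4 a.1).1) ∘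
        (fun a : Fin 4 × ZMod 167 => (a.1, a.2 + (mR a.1 : ZMod 167))) := funext fun a => hfR a
    rw [this]; exact hbR0.comp (shiftBij mR)
  have hbC : Function.Bijective fC := by
    have : fC = (fun a : Fin 4 × ZMod 167 => (κ ^ a.2.val) (eC4 a.1).1) ∘
        (fun a : Fin 4 × ZMod 167 => (a.1, a.2 + (mC a.1 : ZMod 167))) := funext fun a => hfC a
    rw [this]; exact hbC0.comp (shiftBij mC)
  let ER : Fin 4 × ZMod 167 ≃ ι := Equiv.ofBijective fR hbR
  let EC : Fin 4 × ZMod 167 ≃ ι := Equiv.ofBijective fC hbC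
  -- the 16 sequences
  refine ⟨fun p q r => H' (bR p) ((κ ^ r.val) (bC q)), ?_, by simp [ZMod.card], fun p q r => ?_⟩
  · -- the array is the reindexed H'
    have hentry : ∀ a b : Fin 4 × ZMod 167,
        H' (bR a.1) ((κ ^ (b.2 - a.2).val) (bC b.1)) = H' (ER a) (EC b) := by
      intro a b
      show H' (bR a.1) ((κ ^ (b.2 - a.2).val) (bC b.1)) = H' ((π ^ a.2.val) (bR a.1)) ((κ ^ b.2.val) (bC b.1))
      have e1 : (κ ^ b.2.val) (bC b.1) = (κ ^ a.2.val) ((κ ^ (b.2 - a.2).val) (bC b.1)) := by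
        rw [← Equiv.Perm.mul_apply, ← pow_add, ← pow_mod_of_pow_eq_one κ hκ (a.2.val + (b.2 - a.2).val), ← ZMod.val_add,
          add_sub_cancel]
      rw [e1, perm_aut_pow hinv' a.2.val]
    have hM : (Matrix.of fun (a b : Fin 4 × ZMod 167) => H' (bR a.1) ((κ ^ (b.2 - a.2).val) (bC b.1))) =
        H'.submatrix ER EC := by
      ext a b
      rw [Matrix.of_apply, Matrix.submatrix_apply, hentry]
    rw [hM]
    refine ⟨fun a b => hH'.1 _ _, ?_⟩
    rw [Matrix.transpose_submatrix, Matrix.submatrix_mul_equiv, hH'.2]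
    ext a b
    rw [Matrix.submatrix_apply, Matrix.smul_apply, Matrix.one_apply, Matrix.smul_apply, Matrix.one_apply, hι]
    simp only [EmbeddingLike.apply_eq_iff_eq]
    simp [ZMod.card]
  · -- symmetry from the inverting automorphism at the τ-fixed base points
    have hμ' : (μ : ZMod 167) = -1 := by
      rw [← ZMod.natCast_mod μ 167, hμ]; exact zmod167_166
    have h1 := hτ (bR p) ((κ ^ r.val) (bC q))
    rw [hbRfix, heκpow, norm_apply_pow hnκ r.val (bC q), hbCfix] at h1
    -- κ^(μ r.val) = κ^((-r).val)
    have e1 : κ ^ (μ * r.val) = κ ^ (-r).val := by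
      apply pow_eq_pow_of_natCast_eq_n hκ
      rw [ZMod.natCast_zmod_val]; push_cast; rw [ZMod.natCast_zmod_val, hμ']; ring
    rw [e1] at h1
    -- the sign η = d₁ (bR p) * e₁ (bC q) is +1 (put r = 0)
    have h0 := hτ (bR p) (bC q)
    rw [hbRfix, hbCfix] at h0
    have hη : d₁ (bR p) * e₁ (bC q) = 1 := by
      have hne0 : H' (bR p) (bC q) ≠ 0 := hH'ne _ _
      have : (d₁ (bR p) * e₁ (bC q) - 1) * H' (bR p) (bC q) = 0 := by linarith
      rcases mul_eq_zero.mp this with h9 | h9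
      · linarith
      · exact (hne0 h9).elim
    rw [hη, one_mul] at h1
    exact h1

end main

/-! ### the converse: symmetric circulant arrays have the block reversal -/

/-- **A `4 × 4` array of SYMMETRIC circulant blocks has the block reversal `(p, s) ↦ (p, −s)` as a permutation automorphism,
preserving every block and inverting the block shift.** -/
theorem symmetricCirculantArray_inverting_aut (x : Fin 4 → Fin 4 → ZMod 167 → ℤ) (hsym : ∀ p q r, x p q (-r) = x p q r) :
    IsSignedAut (Matrix.of fun (a b : Fin 4 × ZMod 167) => x a.1 b.1 (b.2 - a.2))
        (Equiv.prodCongr (Equiv.refl (Fin 4)) (Equiv.neg (ZMod 167)))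
        (Equiv.prodCongr (Equiv.refl (Fin 4)) (Equiv.neg (ZMod 167))) (fun _ => 1) (fun _ => 1) ∧
      (Equiv.prodCongr (Equiv.refl (Fin 4)) (Equiv.neg (ZMod 167)) : Equiv.Perm (Fin 4 × ZMod 167)) *
          Equiv.prodCongr (Equiv.refl (Fin 4)) (Equiv.addRight (1 : ZMod 167)) =
        (Equiv.prodCongr (Equiv.refl (Fin 4)) (Equiv.addRight (1 : ZMod 167))) ^ 166 *
          Equiv.prodCongr (Equiv.refl (Fin 4)) (Equiv.neg (ZMod 167)) ∧
      ∀ a : Fin 4 × ZMod 167, (Equiv.prodCongr (Equiv.refl (Fin 4)) (Equiv.neg (ZMod 167))) a ∈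
        orbFin (Equiv.prodCongr (Equiv.refl (Fin 4)) (Equiv.addRight (1 : ZMod 167))) 167 a := by
  set σ₀ : Equiv.Perm (Fin 4 × ZMod 167) := Equiv.prodCongr (Equiv.refl (Fin 4)) (Equiv.addRight (1 : ZMod 167)) with hσ₀
  set τ₀ : Equiv.Perm (Fin 4 × ZMod 167) := Equiv.prodCongr (Equiv.refl (Fin 4)) (Equiv.neg (ZMod 167)) with hτ₀
  have hσapp : ∀ k : ℕ, ∀ a : Fin 4 × ZMod 167, (σ₀ ^ k) a = (a.1, a.2 + k) := by
    intro k
    induction k with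
    | zero => intro a; simp
    | succ k ih =>
      intro a
      rw [pow_succ', Equiv.Perm.mul_apply, ih]
      simp only [hσ₀, Equiv.prodCongr_apply, Equiv.coe_refl, Prod.map_apply, id_eq, Equiv.coe_addRight]
      push_cast
      rw [add_assoc]
  have hτapp : ∀ a : Fin 4 × ZMod 167, τ₀ a = (a.1, -a.2) := fun ⟨p, s⟩ => rfl
  have hσ1 : ∀ a : Fin 4 × ZMod 167, σ₀ a = (a.1, a.2 + 1) := fun ⟨p, s⟩ => rfl
  refine ⟨⟨fun _ => Or.inl rfl, fun _ => Or.inl rfl, fun a b => ?_⟩, ?_, fun a => ?_⟩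
  · rw [Matrix.of_apply, Matrix.of_apply, hτapp, hτapp]
    simp only [one_mul]
    rw [show -b.2 - -a.2 = -(b.2 - a.2) by ring, hsym]
  · apply Equiv.ext
    intro a
    rw [Equiv.Perm.mul_apply, Equiv.Perm.mul_apply, hσ1, hτapp, hτapp, hσapp]
    refine Prod.ext rfl ?_
    show -(a.2 + 1) = -a.2 + ((166 : ℕ) : ZMod 167)
    rw [zmod167_166]; ring
  · rw [hτapp]
    refine Finset.mem_image.mpr ⟨((-a.2) - a.2).val, Finset.mem_range.mpr (ZMod.val_lt _), ?_⟩
    rw [hσapp, ZMod.natCast_zmod_val]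
    refine Prod.ext rfl ?_
    show a.2 + (-a.2 - a.2) = -a.2
    ring

/-- **The dictionary (block-preserving inversion at order 167).**  For every `μ` with `μ ≡ 166 (mod 167)`: *some Hadamard matrix
of order `668` has an element `σ` of pair order `167` together with a signed automorphism `τ` with `τστ⁻¹ = σ^μ` that maps every row
and every column into its own `σ`-orbit* **iff** *some Hadamard matrix of order `668` is a `4 × 4` array of SYMMETRIC circulant
`±1` blocks of order `167`.* -/
theorem hadamard668_aut167_inverting_iff_symmetricCirculantArray (μ : ℕ) (hμ : μ % 167 = 166) :
    (∃ (ι : Type) (_ : Fintype ι) (_ : DecidableEq ι) (H : Matrix ι ι ℤ) (π κ π' κ' : Equiv.Perm ι)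
        (d e d' e' : ι → ℤ),
        Fintype.card ι = 668 ∧ IsHadamardMatrix H ∧ IsSignedAut H π κ d e ∧ π ^ 167 = 1 ∧ κ ^ 167 = 1 ∧
        (π ≠ 1 ∨ κ ≠ 1) ∧ IsSignedAut H π' κ' d' e' ∧ π' * π = π ^ μ * π' ∧ κ' * κ = κ ^ μ * κ' ∧
        (∀ x, π' x ∈ orbFin π 167 x) ∧ (∀ y, κ' y ∈ orbFin κ 167 y)) ↔
    ∃ x : Fin 4 → Fin 4 → ZMod 167 → ℤ,
      IsHadamardMatrix (Matrix.of fun (a b : Fin 4 × ZMod 167) => x a.1 b.1 (b.2 - a.2)) ∧ ∀ p q r, x p q (-r) = x p q r := by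
  constructor
  · rintro ⟨ι, _, _, H, π, κ, π', κ', d, e, d', e', hι, hH, haut, hπ, hκ, hne, haut', hnπ, hnκ, hrows, hcols⟩
    obtain ⟨x, hx, -, hsym⟩ := exists_symmetricCirculantArray_of_inverting hH hι haut hπ hκ hne haut' hnπ hnκ hμ hrows hcols
    exact ⟨x, hx, hsym⟩
  · rintro ⟨x, hx, hsym⟩
    obtain ⟨hautσ, hcard, hord⟩ := hadamard668_circulantArray_aut167 x hx
    obtain ⟨hautτ, hcomm, hblocks⟩ := symmetricCirculantArray_inverting_aut x hsym
    set σ₀ : Equiv.Perm (Fin 4 × ZMod 167) := Equiv.prodCongr (Equiv.refl (Fin 4)) (Equiv.addRight (1 : ZMod 167)) with hσ₀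
    have h167 : σ₀ ^ 167 = 1 := by
      have h := pow_orderOf_eq_one ((σ₀, σ₀) : Equiv.Perm (Fin 4 × ZMod 167) × Equiv.Perm (Fin 4 × ZMod 167))
      rw [hord, Prod.pow_mk, Prod.mk_eq_one] at h
      exact h.1
    have hne : σ₀ ≠ 1 := by
      intro h1
      have h2 := congrArg (fun ρ : Equiv.Perm (Fin 4 × ZMod 167) => (ρ ((0 : Fin 4), (0 : ZMod 167))).2) h1
      have h3 : ((0 : ZMod 167) + 1) = 0 := h2
      exact absurd h3 (by decide)
    -- σ₀^μ = σ₀^166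
    have hpow : σ₀ ^ μ = σ₀ ^ 166 := by
      rw [← pow_mod_of_pow_eq_one σ₀ h167 μ, hμ]
    refine ⟨Fin 4 × ZMod 167, inferInstance, inferInstance, _, σ₀, σ₀, _, _, _, _, _, _, hcard, hx, hautσ, h167, h167,
      Or.inl hne, hautτ, ?_, ?_, hblocks, hblocks⟩
    · rw [hpow]; exact hcomm
    · rw [hpow]; exact hcomm

end Summit.Ventures.DiscreteObjects.Hadamard
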